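import Literature.Analysis.FluidPDE.KatoLaiCellUniqueness
import HarnessLib

/-!
# Kato–Lai in the periodic cylinder: the level-`3` energy seen from the level-`s` space

Analysis/FluidPDE support file for the energy-method construction of Euler flows in the
periodic cylinder (`Literature.Analysis.FluidPDE.KatoLai1984_periodicCylinderUniformExistence`;
Kato–Lai 1984, §6, proof of Thm II: the `H^s` solution lives as long as the `H^{s₀}` solution —
here prepared by controlling the pure level-`3` energy `e₃ = ‖u‖²_{H⁰} + ∑ᵢ ‖∂ᵢ³u‖²` along a
solution of the level-`s` problem, through the tame level-`3` estimate of
`KatoLaiTorusOperator.exists_abs_pairing_klOp_le`). With `w = klWeight s ε`: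

* `d3Symbol s ε k = √(pureSq 3 k) / w(k)` (`≤ 1`) and `d3pSymbol s ε k = pureSq 3 k / w(k)`
  (`≤ 7/|ε|` for `s ≥ 6`, **vanishing at infinity** for `s ≥ 7`); the diagonal operators
  `d3Op`, `d3pOp`; `inner_embed_d3pOp : ⟪i (D′f), g⟫ = ⟪D f, D g⟫`;
* `inner_klOpApprox_d3pOp_trunc` — `⟪𝒜̂_N f, D′ (trunc N f)⟫ = P₃(truncField N f)`, the level-`3`
  pairing of `KatoLaiTorusOperator`, and its tame bound
  `|P₃| ≤ 128 K₃ ‖D (trunc N f)‖³`; in the limit **`|⟪𝒜̂ f, D′ f⟫| ≤ 128 K₃ ‖D f‖³`**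
  (`abs_inner_klOpExt_d3pOp_le`) with `K₃ = K₃(L)` independent of `s` and `ε`.

Everything is proved; no named fact and no `sorry` is introduced.

## References

* T. Kato, C. Y. Lai, J. Funct. Anal. 56 (1984) 15–28, §5 (5.7)–(5.8), §6. [KatoLai1984]
-/

noncomputable section

open MeasureTheory Set Function Filter Topology TopologicalSpace Finset
open scoped NNReal ENNReal InnerProductSpace RealInnerProductSpace

namespace Literature.Analysis.FluidPDE

open FunctionSpaces FunctionSpaces.Torus UnitAddTorus

/-- Local notation for physical space `ℝ³ = EuclideanSpace ℝ (Fin 3)`. -/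
local notation "ℝ³" => EuclideanSpace ℝ (Fin 3)

namespace PeriodicCylinder

/-! ### Comparison of the pure weights of levels `3` and `s` -/

/-- `(2π|kᵢ|)^{2·3·2} ≤ 1 + ((2π|kᵢ|)^s)²` for `s ≥ 6`: `a¹² ≤ 1 + a^{2s}`. [folklore] -/
theorem pow_twelve_le (a : ℝ) (ha : 0 ≤ a) {s : ℕ} (hs : 6 ≤ s) : (a ^ 3) ^ 2 * (a ^ 3) ^ 2 ≤ 1 + (a ^ s) ^ 2 := by
  rw [← pow_mul, ← pow_add, ← pow_mul]
  norm_num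
  rcases le_or_gt a 1 with h | h
  · have : a ^ 12 ≤ 1 := pow_le_one₀ ha h
    have : 0 ≤ a ^ (s * 2) := pow_nonneg ha _
    linarith
  · have : a ^ 12 ≤ a ^ (s * 2) := pow_le_pow_right₀ h.le (by omega)
    linarith

/-- **`pureSq 3 k ² ≤ 40 · pureSq s k`** for `s ≥ 6`. [folklore] -/
theorem pureSq_three_sq_le {s : ℕ} (hs : 6 ≤ s) (k : Fin 3 → ℤ) : pureSq 3 k ^ 2 ≤ 40 * pureSq s k := by
  unfold pureSq
  set a : Fin 3 → ℝ := fun i => 2 * Real.pi * |(k i : ℝ)| with ha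
  have ha0 : ∀ i, 0 ≤ a i := fun i => by positivity
  -- `(1 + Σ xᵢ)² ≤ 4 (1 + (Σ xᵢ)²) ≤ 4 (1 + 3 Σ xᵢ²)`
  have hx : ∀ i, 0 ≤ (a i ^ 3) ^ 2 := fun i => sq_nonneg _
  have hsum : (∑ i, (a i ^ 3) ^ 2) ^ 2 ≤ 3 * ∑ i, ((a i ^ 3) ^ 2) ^ 2 := by
    have := sq_sum_le_card_mul_sum_sq (s := (univ : Finset (Fin 3))) (f := fun i => (a i ^ 3) ^ 2)
    simpa using this
  have hterm : ∀ i, ((a i ^ 3) ^ 2) ^ 2 ≤ 1 + (a i ^ s) ^ 2 := fun i => by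
    rw [sq]; exact pow_twelve_le (a i) (ha0 i) hs
  have h3 : ∑ i, ((a i ^ 3) ^ 2) ^ 2 ≤ ∑ i : Fin 3, (1 + (a i ^ s) ^ 2) := sum_le_sum fun i _ => hterm i
  rw [sum_add_distrib, sum_const, card_univ, Fintype.card_fin] at h3
  simp only [nsmul_eq_mul, Nat.cast_ofNat, mul_one] at h3
  have hS : 0 ≤ ∑ i, (a i ^ 3) ^ 2 := sum_nonneg fun i _ => hx i
  have hSs : 0 ≤ ∑ i, (a i ^ s) ^ 2 := sum_nonneg fun i _ => sq_nonneg _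
  nlinarith

/-! ### The symbols -/

/-- The symbol `√p₃ / w` carrying the pure level-`3` energy. [folklore] -/
def d3Symbol (s : ℕ) (ε : ℝ) (k : Fin 3 → ℤ) : ℝ := Real.sqrt (pureSq 3 k) * (klWeight s ε k)⁻¹

/-- The symbol `p₃ / w`. [folklore] -/
def d3pSymbol (s : ℕ) (ε : ℝ) (k : Fin 3 → ℤ) : ℝ := pureSq 3 k * (klWeight s ε k)⁻¹

/-- `0 < d3Symbol`. [folklore] -/
theorem d3Symbol_pos (s : ℕ) (ε : ℝ) (k : Fin 3 → ℤ) : 0 < d3Symbol s ε k :=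
  mul_pos (Real.sqrt_pos.2 (lt_of_lt_of_le one_pos (one_le_pureSq 3 k))) (inv_pos.2 (klWeight_pos s ε k))

/-- `0 < d3pSymbol`. [folklore] -/
theorem d3pSymbol_pos (s : ℕ) (ε : ℝ) (k : Fin 3 → ℤ) : 0 < d3pSymbol s ε k :=
  mul_pos (lt_of_lt_of_le one_pos (one_le_pureSq 3 k)) (inv_pos.2 (klWeight_pos s ε k))

/-- `|d3Symbol| ≤ 1` (`p₃ ≤ w²`). [folklore] -/
theorem abs_d3Symbol_le (s : ℕ) (ε : ℝ) (k : Fin 3 → ℤ) : |d3Symbol s ε k| ≤ 1 := by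
  rw [abs_of_pos (d3Symbol_pos s ε k), d3Symbol, mul_inv_le_iff₀ (klWeight_pos s ε k), one_mul, klWeight]
  refine Real.sqrt_le_sqrt ?_
  have : 0 ≤ ε ^ 2 * pureSq s k := mul_nonneg (sq_nonneg _) (zero_le_one.trans (one_le_pureSq s k))
  linarith

/-- `d3Symbol` is even. [folklore] -/
theorem d3Symbol_neg (s : ℕ) (ε : ℝ) (k : Fin 3 → ℤ) : d3Symbol s ε (-k) = d3Symbol s ε k := by
  rw [d3Symbol, d3Symbol, pureSq_neg, (isWeight_klWeight s ε).even]

/-- `d3pSymbol` is even. [folklore] -/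
theorem d3pSymbol_neg (s : ℕ) (ε : ℝ) (k : Fin 3 → ℤ) : d3pSymbol s ε (-k) = d3pSymbol s ε k := by
  rw [d3pSymbol, d3pSymbol, pureSq_neg, (isWeight_klWeight s ε).even]

/-- **`|d3pSymbol| ≤ 7 / |ε|`** for `s ≥ 6` and `ε ≠ 0` (`p₃ ≤ √40 √p_s ≤ 7 w/|ε|`). [folklore] -/
theorem abs_d3pSymbol_le {s : ℕ} (hs : 6 ≤ s) {ε : ℝ} (hε : ε ≠ 0) (k : Fin 3 → ℤ) : |d3pSymbol s ε k| ≤ 7 / |ε| := by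
  rw [abs_of_pos (d3pSymbol_pos s ε k), d3pSymbol, mul_inv_le_iff₀ (klWeight_pos s ε k)]
  have hε' : 0 < |ε| := abs_pos.2 hε
  have hps : 0 ≤ pureSq s k := zero_le_one.trans (one_le_pureSq s k)
  have hp3 : 0 ≤ pureSq 3 k := zero_le_one.trans (one_le_pureSq 3 k)
  -- `|ε| √p_s ≤ w`
  have hw : |ε| * Real.sqrt (pureSq s k) ≤ klWeight s ε k := by
    rw [klWeight, show |ε| * Real.sqrt (pureSq s k) = Real.sqrt (ε ^ 2 * pureSq s k) by
      rw [Real.sqrt_mul (sq_nonneg _), Real.sqrt_sq_eq_abs]]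
    exact Real.sqrt_le_sqrt (by linarith)
  -- `p₃ ≤ 7 √p_s`
  have h40 := pureSq_three_sq_le hs k
  have hp : pureSq 3 k ≤ 7 * Real.sqrt (pureSq s k) := by
    have h1 : pureSq 3 k ^ 2 ≤ (7 * Real.sqrt (pureSq s k)) ^ 2 := by
      rw [mul_pow, Real.sq_sqrt hps]; linarith
    exact (pow_le_pow_iff_left₀ hp3 (by positivity) two_ne_zero).1 h1
  calc pureSq 3 k ≤ 7 * Real.sqrt (pureSq s k) := hp
    _ = 7 / |ε| * (|ε| * Real.sqrt (pureSq s k)) := by field_simp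
    _ ≤ 7 / |ε| * klWeight s ε k := mul_le_mul_of_nonneg_left hw (by positivity)

/-- **`d3pSymbol` vanishes at infinity** for `s ≥ 7` and `ε ≠ 0`. [folklore] -/
theorem vanishingSymbol_d3pSymbol {s : ℕ} (hs : 7 ≤ s) {ε : ℝ} (hε : ε ≠ 0) : SymL2.VanishingSymbol (d3pSymbol s ε) := by
  intro δ hδ
  have hε' : 0 < |ε| := abs_pos.2 hε
  -- `d3p ≤ p₃/(|ε| √p_s)` and `p₃² ≤ 40 p₆`-type bounds: use `p₃ ≤ 7 √p₆` (level 6) and `p₆ (1+|k|²) ≤ C p₇ ≤ C' p_s`.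
  -- Simpler: `d3p(k) = (p₃/w) ≤ p₃/(|ε|√p_s)` and `p₃² (1 + |k|²) ≤ 40 · 4 · p_s`-free route:
  -- we bound `d3p(k)² ≤ 49/ε² · p₆'/p_s` where `p_s ≥ (1+|k|²)^s/4^{s-1}` and `p₃² ≤ 40 p₆ ≤ 40 (1+3(2π)^12)(1+|k|²)^6`.
  have hs6 : 6 ≤ s := by omega
  -- choose `N` with `C / (1 + N²) ≤ δ²`
  set C : ℝ := (40 * (1 + 3 * (2 * Real.pi) ^ (2 * 6))) * 4 ^ (s - 1) / ε ^ 2 with hC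
  have hCpos : 0 < C := by rw [hC]; positivity
  obtain ⟨N, hN⟩ := exists_nat_gt (C / δ ^ 2)
  refine ⟨N, fun k hk => ?_⟩
  rw [mem_freqBall, not_le] at hk
  rw [abs_of_pos (d3pSymbol_pos s ε k)]
  have hk1 : (1 : ℝ) ≤ 1 + freqNormSq k := by linarith [freqNormSq_nonneg k]
  have hwpos := klWeight_pos s ε k
  -- `d3p² = p₃² / w² ≤ 40 p₆-bound / (ε² p_s)`
  have hp3sq : pureSq 3 k ^ 2 ≤ 40 * ((1 + 3 * (2 * Real.pi) ^ (2 * 6)) * (1 + freqNormSq k) ^ 6) :=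
    (pureSq_three_sq_le le_rfl k).trans (mul_le_mul_of_nonneg_left (pureSq_le_latWeight k 6) (by norm_num))
  have hws : ε ^ 2 * (1 + freqNormSq k) ^ s ≤ 4 ^ (s - 1) * klWeight s ε k ^ 2 := sq_mul_latWeight_le_klWeight_sq (by omega) ε k
  have hsq : d3pSymbol s ε k ^ 2 ≤ C / (1 + freqNormSq k) := by
    have hε2 : 0 < ε ^ 2 := by rw [← sq_abs]; exact pow_pos hε' 2
    have hw2 : 0 < klWeight s ε k ^ 2 := pow_pos hwpos 2
    rw [le_div_iff₀ (by linarith), hC, le_div_iff₀ hε2, d3pSymbol, mul_pow, inv_pow]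
    have h7 : (1 + freqNormSq k) ^ 6 * (1 + freqNormSq k) ≤ (1 + freqNormSq k) ^ s := by
      rw [← pow_succ]; exact pow_le_pow_right₀ hk1 (by omega)
    rw [show pureSq 3 k ^ 2 * (klWeight s ε k ^ 2)⁻¹ * (1 + freqNormSq k) * ε ^ 2 =
        (pureSq 3 k ^ 2 * (1 + freqNormSq k)) * (ε ^ 2 / klWeight s ε k ^ 2) by field_simp]
    have hA : pureSq 3 k ^ 2 * (1 + freqNormSq k) ≤ 40 * (1 + 3 * (2 * Real.pi) ^ (2 * 6)) * (1 + freqNormSq k) ^ s := by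
      calc pureSq 3 k ^ 2 * (1 + freqNormSq k) ≤ 40 * ((1 + 3 * (2 * Real.pi) ^ (2 * 6)) * (1 + freqNormSq k) ^ 6) * (1 + freqNormSq k) :=
            mul_le_mul_of_nonneg_right hp3sq (by linarith)
        _ = 40 * (1 + 3 * (2 * Real.pi) ^ (2 * 6)) * ((1 + freqNormSq k) ^ 6 * (1 + freqNormSq k)) := by ring
        _ ≤ _ := mul_le_mul_of_nonneg_left h7 (by positivity)
    have hB : (1 + freqNormSq k) ^ s * (ε ^ 2 / klWeight s ε k ^ 2) ≤ 4 ^ (s - 1) := by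
      rw [mul_div_assoc', div_le_iff₀ hw2]; linarith
    calc pureSq 3 k ^ 2 * (1 + freqNormSq k) * (ε ^ 2 / klWeight s ε k ^ 2)
        ≤ 40 * (1 + 3 * (2 * Real.pi) ^ (2 * 6)) * (1 + freqNormSq k) ^ s * (ε ^ 2 / klWeight s ε k ^ 2) :=
          mul_le_mul_of_nonneg_right hA (by positivity)
      _ = 40 * (1 + 3 * (2 * Real.pi) ^ (2 * 6)) * ((1 + freqNormSq k) ^ s * (ε ^ 2 / klWeight s ε k ^ 2)) := by ring
      _ ≤ 40 * (1 + 3 * (2 * Real.pi) ^ (2 * 6)) * 4 ^ (s - 1) := mul_le_mul_of_nonneg_left hB (by positivity)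
  have hlt : C / (1 + freqNormSq k) < δ ^ 2 := by
    rw [div_lt_iff₀ (by linarith)]
    have hN' : C / δ ^ 2 < 1 + freqNormSq k := by
      have : (N : ℝ) ^ 2 < freqNormSq k := hk
      have hN0 : (0 : ℝ) ≤ N := Nat.cast_nonneg N
      nlinarith
    rwa [div_lt_iff₀ (by positivity), mul_comm] at hN'
  exact ((pow_lt_pow_iff_left₀ (d3pSymbol_pos s ε k).le hδ.le two_ne_zero).1 (hsq.trans_lt hlt)).le

/-! ### The diagonal operators and the coefficient identities -/

section Ops

variable (s : ℕ) (ε : ℝ)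

/-- `D = diag (√p₃/w)`: `‖D f‖²` is the pure level-`3` energy of the physical field of `f`. [folklore] -/
def d3Op : SymL2 (Fin 3) →L[ℝ] SymL2 (Fin 3) := SymL2.diag (d3Symbol s ε) (abs_d3Symbol_le s ε) (d3Symbol_neg s ε)

variable {s ε}

/-- `D′ = diag (p₃/w)` (bounded for `s ≥ 6`, `ε ≠ 0`). [folklore] -/
def d3pOp (hs : 6 ≤ s) (hε : ε ≠ 0) : SymL2 (Fin 3) →L[ℝ] SymL2 (Fin 3) :=
  SymL2.diag (d3pSymbol s ε) (abs_d3pSymbol_le hs hε) (d3pSymbol_neg s ε)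

variable (hs : 6 ≤ s) (hε : ε ≠ 0)

/-- **`⟪i (D′ f), g⟫ = ⟪D f, D g⟫`** (symbols `w⁻¹ · p₃/w = (√p₃/w)²`). [folklore] -/
theorem inner_embed_d3pOp (f g : SymL2 (Fin 3)) : ⟪embed s ε (d3pOp hs hε f), g⟫_ℝ = ⟪d3Op s ε f, d3Op s ε g⟫_ℝ := by
  refine (SymL2.hasSum_inner _ g).unique ((SymL2.hasSum_inner (d3Op s ε f) (d3Op s ε g)).congr_fun fun k => ?_)
  simp only [embed_apply, d3pOp, d3Op, SymL2.diag_apply, smul_smul, inner_smul_left, inner_smul_right, ← mul_assoc]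
  have hw := (klWeight_pos s ε k).ne'
  have hp : 0 ≤ pureSq 3 k := zero_le_one.trans (one_le_pureSq 3 k)
  congr 1
  · simp only [map_mul, Complex.conj_ofReal, map_inv₀]
    rw [d3pSymbol, d3Symbol]
    push_cast
    rw [show ((Real.sqrt (pureSq 3 k) : ℝ) : ℂ) * ((klWeight s ε k : ℝ) : ℂ)⁻¹ * (((Real.sqrt (pureSq 3 k) : ℝ) : ℂ) * ((klWeight s ε k : ℝ) : ℂ)⁻¹) =
      (((Real.sqrt (pureSq 3 k) : ℝ) : ℂ) * ((Real.sqrt (pureSq 3 k) : ℝ) : ℂ)) * (((klWeight s ε k : ℝ) : ℂ)⁻¹ * ((klWeight s ε k : ℝ) : ℂ)⁻¹) by ring]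
    rw [← Complex.ofReal_mul, Real.mul_self_sqrt hp]
    ring

/-- `‖D f‖² = ⟪i (D′ f), f⟫`. [folklore] -/
theorem norm_d3Op_sq (f : SymL2 (Fin 3)) : ‖d3Op s ε f‖ ^ 2 = ⟪embed s ε (d3pOp hs hε f), f⟫_ℝ := by
  rw [inner_embed_d3pOp, real_inner_self_eq_norm_sq]

/-- `D` and `D′` commute with truncation. [folklore] -/
theorem d3Op_trunc (N : ℕ) (f : SymL2 (Fin 3)) : d3Op s ε (SymL2.trunc N f) = SymL2.trunc N (d3Op s ε f) := by
  refine SymL2.ext fun k => ?_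
  simp only [d3Op, SymL2.diag_apply, SymL2.trunc_apply]
  split_ifs <;> simp

/-- `‖D (trunc N f)‖ ≤ ‖D f‖`. [folklore] -/
theorem norm_d3Op_trunc_le (N : ℕ) (f : SymL2 (Fin 3)) : ‖d3Op s ε (SymL2.trunc N f)‖ ≤ ‖d3Op s ε f‖ := by
  rw [d3Op_trunc]; exact SymL2.norm_trunc_le N _

/-- **`lat₃ (truncField N f) ≤ 16 ‖D (trunc N f)‖²`** and the same for `lat₀`. [folklore] -/
theorem latNormSq_three_truncField_le_d3 (N : ℕ) (f : SymL2 (Fin 3)) :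
    Torus.latNormSq 3 (truncField s ε N f) ≤ 16 * ‖d3Op s ε (SymL2.trunc N f)‖ ^ 2 := by
  have hU := isSmooth_truncField s ε N f
  have h := SymL2.hasSum_norm_sq_diag (d3Symbol s ε) (abs_d3Symbol_le s ε) (d3Symbol_neg s ε) (toSym s ε hU)
  have hval : ‖SymL2.diag (d3Symbol s ε) (abs_d3Symbol_le s ε) (d3Symbol_neg s ε) (toSym s ε hU)‖ ^ 2 =
      ‖d3Op s ε (SymL2.trunc N f)‖ ^ 2 := by
    rw [toSym_truncField]; rfl
  unfold Torus.latNormSq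
  rw [← hval, ← (h.mul_left 16).tsum_eq]
  refine (Torus.summable_latWeight hU 3).tsum_le_tsum (fun k => ?_) ((h.mul_left 16).summable)
  rw [SymL2.ofSmooth_apply, norm_smul, Complex.norm_real, Real.norm_of_nonneg (klWeight_pos s ε k).le]
  have hw := (klWeight_pos s ε k).ne'
  have hp : 0 ≤ pureSq 3 k := zero_le_one.trans (one_le_pureSq 3 k)
  set a := ‖mFourierCoeff (EuclideanSpace.complexify ∘ truncField s ε N f) k‖ with ha
  have e : d3Symbol s ε k ^ 2 * (klWeight s ε k * a) ^ 2 = pureSq 3 k * a ^ 2 := by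
    rw [d3Symbol, mul_pow, mul_pow, inv_pow, Real.sq_sqrt hp]
    field_simp
  rw [e]
  have h16 := latWeight_le_pureSq k (m := 3) (by norm_num)
  norm_num at h16
  nlinarith [sq_nonneg a]

end Ops

end PeriodicCylinder

end Literature.Analysis.FluidPDE
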